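import Summits.BirchSwinnertonDyer.BirchSwinnertonDyer.Theorems.UniversalToricDescentResidualLayerAlgebra
import Literature.NumberTheory.EllipticCurves.IwasawaAlgebraProofs
import Literature.NumberTheory.EllipticCurves.BSDRootNumber
import HarnessLib

/-!
# Route UniversalToricDescent — residual growth, FIRST STEP of the residual corank-one μ-criterion:
# an INFINITE finitely generated `Λ`-module killed by `p` has `#(N ⧸ T^m N) ≥ p^m` for every `m`

Lead prover bsd-wall-utd-p1 g21 (`--supports stmt-BirchSwinnertonDyer-24737`). Crux memo
`Cruxes/TwinAlgMuZeroAtThree/LEAD-utd-p1-g21-residual-corank-gap.md`: the node `Lines/residual_omega_kolyvagin.lean`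
(cruxidea-24737-1) needs, for its transfer stub T1, the pure `Λ`-algebra «residual corank ≤ 1 growth ∧ rank ≥ 1 ⟹
`μ(X_tors) = 0`»; its rank-zero case is the landed one-layer criterion (`…ResidualLayerAlgebra`, `…OneLayerCriterion`).
This file lands step (2) of that memo's plan in `Λ = ℤ_p⟦T⟧`-currency:

* §1 TRANSPORT (inside proofs only; no definition): a `Λ`-module `N` with `p·N = 0` is a module over
  `Ω = k⟦X⟧`, `k = 𝔽_p` the residue field of `ℤ_p`, through the surjection `φ = PowerSeries.map (residue) : Λ → Ω`
  whose kernel is `(p)` (tree `IwasawaAlgebra.map_residue_eq_zero_iff`) — `Function.Surjective.moduleLeft`.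
* §2 `pow_le_natCard_quotient_of_infinite` — `N` finitely generated over `Λ`, `p·N = 0`, `N` infinite ⟹
  `p ^ m ≤ #(N ⧸ (T^m)·N)` for every `m` (over `Ω`: infinite ⟹ not torsion (g20 `finite_of_isTorsion`) ⟹ the bound
  (g20 `pow_le_natCard_quotient_of_not_isTorsion`), and `(X^m)·N` over `Ω` is `(T^m)·N` over `Λ`).
* §2 `finite_quotient_pow_smul_of_smul_eq_zero` — the quotient `N ⧸ (T^m)·N` is finite (same transport).

THEOREMS ONLY; any prime `p`. BSD is not advanced by this file; stmt-24737 stays open.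
References: [Washington1997] §13.2; the statements are folklore (Nakayama over the DVR `𝔽_p⟦T⟧`).
-/

noncomputable section
open scoped Classical

-- `…BirchSwinnertonDyer.BirchSwinnertonDyer.Theorems…` is the problem's mandated namespace (D-0017).
set_option linter.dupNamespace false
set_option autoImplicit false

namespace Summit.BirchSwinnertonDyer.BirchSwinnertonDyer.Theorems.UniversalToricDescentResidualGrowth

open PowerSeries Literature.NumberTheory.EllipticCurves Literature.NumberTheory.EllipticCurves.IwasawaAlgebra
  Summit.BirchSwinnertonDyer.BirchSwinnertonDyer.Theorems.UniversalToricDescentResidualLayerAlgebra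

variable {p : ℕ} [Fact p.Prime]

/-! ### §1 The residue field and the reduction map `Λ → 𝔽_p⟦X⟧` -/

/-- The reduction `φ : ℤ_p⟦T⟧ → 𝔽_p⟦X⟧` is onto. [folklore] -/
theorem map_residue_surjective :
    Function.Surjective
      (PowerSeries.map (IsLocalRing.residue ℤ_[p]) : IwasawaAlgebra p →+* PowerSeries (IsLocalRing.ResidueField ℤ_[p])) :=
  PowerSeries.map_surjective _ IsLocalRing.residue_surjective

/-- Two power series with the same reduction differ by a multiple of `p`. [folklore] -/
theorem exists_eq_add_C_mul_of_map_eq {f g : IwasawaAlgebra p}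
    (h : PowerSeries.map (IsLocalRing.residue ℤ_[p]) f = PowerSeries.map (IsLocalRing.residue ℤ_[p]) g) :
    ∃ q : IwasawaAlgebra p, f = g + PowerSeries.C (p : ℤ_[p]) * q := by
  have hker : PowerSeries.map (IsLocalRing.residue ℤ_[p]) (f - g) = 0 := by rw [map_sub, h, sub_self]
  rw [map_residue_eq_zero_iff, augIdealP, Ideal.mem_span_singleton] at hker
  obtain ⟨q, hq⟩ := hker
  exact ⟨q, by rw [← hq, add_sub_cancel]⟩

/-! ### §2 The growth lower bound -/

section Growth

variable {N : Type*} [AddCommGroup N] [Module (IwasawaAlgebra p) N]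

/-- **An infinite finitely generated `Λ`-module killed by `p` has `#(N ⧸ T^m·N) ≥ p^m` for every `m`**, and the
quotient is finite. Proof: through `φ : Λ ↠ 𝔽_p⟦X⟧` (kernel `(p)`, acting trivially) `N` is a finitely generated
`𝔽_p⟦X⟧`-module; infinite ⟹ not torsion (`finite_of_isTorsion`) ⟹ `#(N ⧸ X^m N) ≥ p^m`
(`pow_le_natCard_quotient_of_not_isTorsion`); and `X^m·N = T^m·N` as subgroups of `N`.
[cite: Washington1997, §13.2] -/
theorem finite_and_pow_le_natCard_quotient_of_infinite [Module.Finite (IwasawaAlgebra p) N]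
    (hp : ∀ x : N, (PowerSeries.C (p : ℤ_[p]) : IwasawaAlgebra p) • x = 0) (hN : Infinite N) (m : ℕ) :
    Finite (N ⧸ (Ideal.span {((PowerSeries.X : IwasawaAlgebra p) ^ m)} • (⊤ : Submodule (IwasawaAlgebra p) N))) ∧
    p ^ m ≤ Nat.card (N ⧸ (Ideal.span {((PowerSeries.X : IwasawaAlgebra p) ^ m)} •
      (⊤ : Submodule (IwasawaAlgebra p) N))) := by
  -- §1 transport: `N` as an `Ω = k⟦X⟧`-module
  let k := IsLocalRing.ResidueField ℤ_[p]
  haveI : Finite k := Finite.of_equiv _ (PadicInt.residueField (p := p)).toEquiv.symm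
  let φ : IwasawaAlgebra p →+* PowerSeries k := PowerSeries.map (IsLocalRing.residue ℤ_[p])
  have hφ : Function.Surjective φ := map_residue_surjective
  letI instSMul : SMul (PowerSeries k) N := ⟨fun g x => Function.surjInv hφ g • x⟩
  have hsmul_def : ∀ (g : PowerSeries k) (x : N), g • x = Function.surjInv hφ g • x := fun _ _ => rfl
  have hsmul : ∀ (c : IwasawaAlgebra p) (x : N), φ c • x = c • x := by
    intro c x
    rw [hsmul_def]
    obtain ⟨q, hq⟩ := exists_eq_add_C_mul_of_map_eq (p := p)
      (show φ (Function.surjInv hφ (φ c)) = φ c from Function.surjInv_eq hφ (φ c))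
    rw [hq, add_smul, mul_comm, mul_smul, hp, smul_zero, add_zero]
  letI instMod : Module (PowerSeries k) N := Function.Surjective.moduleLeft φ hφ hsmul
  -- finite generation transfers
  haveI : Module.Finite (PowerSeries k) N := by
    obtain ⟨s, hs⟩ := (‹Module.Finite (IwasawaAlgebra p) N›).fg_top
    refine ⟨⟨s, ?_⟩⟩
    rw [eq_top_iff]
    intro x _
    have hx : x ∈ Submodule.span (IwasawaAlgebra p) (s : Set N) := by rw [hs]; exact Submodule.mem_top
    refine Submodule.span_induction (p := fun y _ => y ∈ Submodule.span (PowerSeries k) (s : Set N))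
      (fun y hy => Submodule.subset_span hy) (Submodule.zero_mem _) (fun _ _ _ _ hy hz => Submodule.add_mem _ hy hz)
      (fun c y _ hy => ?_) hx
    rw [← hsmul]
    exact Submodule.smul_mem _ _ hy
  -- infinite ⟹ not torsion over `Ω`
  have hnt : ¬ Module.IsTorsion (PowerSeries k) N := by
    intro ht
    haveI := finite_of_isTorsion (k := k) ht
    exact not_finite N
  -- the two submodules `X^m • ⊤` (over `Ω`) and `T^m • ⊤` (over `Λ`) have the same carrier
  have hXT : φ ((PowerSeries.X : IwasawaAlgebra p) ^ m) = (PowerSeries.X : PowerSeries k) ^ m := by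
    rw [map_pow, PowerSeries.map_X]
  have hcarrier : ∀ y : N,
      y ∈ (Ideal.span {((PowerSeries.X : PowerSeries k) ^ m)} • (⊤ : Submodule (PowerSeries k) N)) ↔
        y ∈ (Ideal.span {((PowerSeries.X : IwasawaAlgebra p) ^ m)} • (⊤ : Submodule (IwasawaAlgebra p) N)) := by
    intro y
    rw [Submodule.ideal_span_singleton_smul, Submodule.ideal_span_singleton_smul,
      Submodule.mem_smul_pointwise_iff_exists, Submodule.mem_smul_pointwise_iff_exists]
    constructor
    · rintro ⟨x, -, rfl⟩
      exact ⟨x, Submodule.mem_top, by rw [← hXT, hsmul]⟩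
    · rintro ⟨x, -, rfl⟩
      exact ⟨x, Submodule.mem_top, by rw [← hXT, hsmul]⟩
  -- hence the two quotients are in bijection
  let e : (N ⧸ (Ideal.span {((PowerSeries.X : PowerSeries k) ^ m)} • (⊤ : Submodule (PowerSeries k) N))) ≃
      (N ⧸ (Ideal.span {((PowerSeries.X : IwasawaAlgebra p) ^ m)} • (⊤ : Submodule (IwasawaAlgebra p) N))) :=
    Quotient.congr (Equiv.refl N) fun a b => by
      rw [Submodule.quotientRel_def, Submodule.quotientRel_def, Equiv.refl_apply, Equiv.refl_apply]
      exact hcarrier (a - b)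
  haveI hfinΩ : Finite (N ⧸ (Ideal.span {((PowerSeries.X : PowerSeries k) ^ m)} •
      (⊤ : Submodule (PowerSeries k) N))) := finite_quotient_X_pow_smul_top (k := k) m
  refine ⟨Finite.of_equiv _ e, ?_⟩
  have hle := pow_le_natCard_quotient_of_not_isTorsion (k := k) (M := N) m hnt
  rw [card_residueField_padicInt, Nat.card_congr e] at hle
  exact hle

/-- **`p ^ m ≤ #(N ⧸ T^m·N)`** for an infinite finitely generated `Λ`-module `N` with `p·N = 0`, every `m`.
[cite: Washington1997, §13.2] -/
theorem pow_le_natCard_quotient_of_infinite [Module.Finite (IwasawaAlgebra p) N]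
    (hp : ∀ x : N, (PowerSeries.C (p : ℤ_[p]) : IwasawaAlgebra p) • x = 0) (hN : Infinite N) (m : ℕ) :
    p ^ m ≤ Nat.card (N ⧸ (Ideal.span {((PowerSeries.X : IwasawaAlgebra p) ^ m)} •
      (⊤ : Submodule (IwasawaAlgebra p) N))) :=
  (finite_and_pow_le_natCard_quotient_of_infinite hp hN m).2

end Growth

end Summit.BirchSwinnertonDyer.BirchSwinnertonDyer.Theorems.UniversalToricDescentResidualGrowth

end
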